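import Summits.ResolutionOfSingularities.ResolutionOfSingularities.Theorems.WeightedInvariantIota3NonreachKCore
import Summits.ResolutionOfSingularities.ResolutionOfSingularities.Theorems.WeightedInvariantSupportedUnitExpansion
import Summits.ResolutionOfSingularities.ResolutionOfSingularities.Theorems.WeightedInvariantKeyRungThreeOfDropCurveNonreachK
import HarnessLib

/-!
# Transport of a face-supported unit expansion of `f` to the pinned successor `B_𝔫` along `x = t⁻¹·X`, `y = (t⁻¹)^b·W`
# (door `HypersurfaceCentreConstruction`, stmt-ResolutionOfSingularities-19897, stub `stub_keyRungGrHomLE_three`; (NONREACH-K) plumbing)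

Helper for `stub_keyRungGrHomLE_three` (def-free, `--supports 19897`).  The last ingredient of (NONREACH-K) (SIGMA-ISO.md rev 3 §2, «the
monomial bookkeeping in a face-form model of `S → B_𝔫`»): a unit expansion `f ≡ Σ_γ a_γ x^{γ₀} y^{γ₁} z^{γ₂} (mod 𝔪_S^M)` supported on the
AQS face (so `γ₀ + bγ₁ ≥ bν`) becomes, at the pinned successor `L = B_𝔫` (`x = T·X` with `X = x t` a unit at `𝔫`, `y = T^b·W`,
`f = T^{bν}·g`), the unit expansion `g ≡ Σ_γ (a_γ X^{γ₀}) · T^{γ₀ + bγ₁ − bν} z^{γ₂} W^{γ₁} (mod 𝔪_L^{M − bν})`.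

* **`LocalGameEFTNewton.mem_pow_of_parameter_pow_mul_mem_pow`** — in a regular local ring, `uᵢ^a · D ∈ 𝔪^M ⟹ D ∈ 𝔪^{M−a}` for a regular
  parameter `uᵢ` (unit expansions + `le_weight_of_mem_weightedMonomialIdeal`).
* **`Iota3.transport_faceExpansion_aux`** / **`Iota3.transport_faceExpansion`** — the transport, for every presentation `(u, w)` of
  `𝒥((y,x);(b,1))` (carrier transport by `subst`, as in …Iota3TieZeroTransformShape).

[OURS · L1 W4.3 · kernel lemmas; AI work, weaker than expert review; nothing here is a statement of the manuscript under review
(Hironaka 2017, [claim: Hironaka2017, status: under-review]).]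

## References

* J. Włodarczyk, *Functorial resolution by torus actions*, arXiv:2203.03090, §2.3.9, §3.3 (local equations `uᵢ = (t⁻¹)^{wᵢ} uᵢ'`). [Wlodarczyk2022]
* H. Matsumura, *Commutative Ring Theory*, CUP 1987, Thm 16.2. [Matsumura1987]
-/

noncomputable section

set_option linter.dupNamespace false -- mandated namespace of this single-conjunct summit

open IsLocalRing Literature.AlgebraicGeometry.Resolution

namespace Summit.ResolutionOfSingularities.ResolutionOfSingularities.Theorems

namespace LocalGameEFTNewton

variable {S : Type} [CommRing S] [IsRegularLocalRing S] {d : ℕ} (u : Fin d → S) (hu : Ideal.span (Set.range u) = maximalIdeal S)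
  (hdim : ringKrullDim S = d)

include hu hdim in
/-- **Cancellation of a regular parameter against `𝔪`-adic order**: `uᵢ · D ∈ 𝔪^{M+1} ⟹ D ∈ 𝔪^M`. [cite: Matsumura1987, Thm. 16.2] -/
theorem mem_pow_of_parameter_mul_mem_pow_succ (i : Fin d) {M : ℕ} {D : S} (h : u i * D ∈ maximalIdeal S ^ (M + 1)) :
    D ∈ maximalIdeal S ^ M := by
  classical
  obtain ⟨Δ, a, hunit, -, hr⟩ := exists_unitExpansion u hu D M
  have hone : ∀ j : Fin d, 0 < (fun _ : Fin d => 1) j := fun _ => one_pos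
  -- the shifted expansion of `uᵢ · D`
  set sh : (Fin d → ℕ) → (Fin d → ℕ) := fun E => E + Pi.single i 1 with hsh
  have hinj : Set.InjOn sh Δ := fun E _ E' _ h => add_right_cancel h
  have hshift : u i * D - ∑ E ∈ Δ.image sh, a (E - Pi.single i 1) * ∏ j, u j ^ E j ∈ maximalIdeal S ^ (M + 1) := by
    rw [Finset.sum_image hinj]
    have h1 : ∀ E ∈ Δ, a (sh E - Pi.single i 1) * ∏ j, u j ^ (sh E) j = u i * (a E * ∏ j, u j ^ E j) := fun E _ => by
      simp only [hsh, add_tsub_cancel_right, prod_pow_add_single u]; ring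
    rw [Finset.sum_congr rfl h1, ← Finset.mul_sum, ← mul_sub, pow_succ']
    exact Ideal.mul_mem_mul (mem_maximalIdeal_of_span_eq u hu i) hr
  have hunit' : ∀ E ∈ Δ.image sh, IsUnit (a (E - Pi.single i 1)) := by
    intro E hE
    obtain ⟨E₀, hE₀, rfl⟩ := Finset.mem_image.mp hE
    simp only [hsh, add_tsub_cancel_right]
    exact hunit E₀ hE₀
  have hge := le_weight_of_mem_weightedMonomialIdeal u hu hdim (fun _ => 1) hone hunit' hshift
    (by rw [weightedMonomialIdeal_const_one_eq_pow u hu]; exact h) le_rfl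
  rw [← weightedMonomialIdeal_const_one_eq_pow u hu]
  refine mem_weightedMonomialIdeal_of_forall_le_weight u hu (fun _ => 1) hone hr (fun E hE => ?_) le_rfl
  have h1 := hge (sh E) (Finset.mem_image_of_mem sh hE)
  simp only [hsh, one_mul, Pi.add_apply, Finset.sum_add_distrib, Pi.single_apply, Finset.sum_ite_eq', Finset.mem_univ,
    if_true] at h1 ⊢
  omega

include hu hdim in
/-- **`uᵢ^a · D ∈ 𝔪^M ⟹ D ∈ 𝔪^{M − a}`** in a regular local ring. [cite: Matsumura1987, Thm. 16.2] -/
theorem mem_pow_of_parameter_pow_mul_mem_pow (i : Fin d) (a : ℕ) {M : ℕ} {D : S} (h : u i ^ a * D ∈ maximalIdeal S ^ M) :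
    D ∈ maximalIdeal S ^ (M - a) := by
  induction a generalizing M with
  | zero => rw [Nat.sub_zero]; rwa [pow_zero, one_mul] at h
  | succ a ih =>
    rcases Nat.eq_zero_or_pos M with hM | hM
    · subst hM; rw [Nat.zero_sub, pow_zero, Ideal.one_eq_top]; exact Submodule.mem_top
    · obtain ⟨M', rfl⟩ : ∃ M', M = M' + 1 := ⟨M - 1, by omega⟩
      have h' : u i * (u i ^ a * D) ∈ maximalIdeal S ^ (M' + 1) := by rwa [← mul_assoc, ← pow_succ']
      have h1 := mem_pow_of_parameter_mul_mem_pow_succ u hu hdim i h'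
      have h2 := ih h1
      rwa [show M' + 1 - (a + 1) = M' - a by omega]

end LocalGameEFTNewton

end Summit.ResolutionOfSingularities.ResolutionOfSingularities.Theorems

namespace Summit.ResolutionOfSingularities.ResolutionOfSingularities.Cruxes.HypersurfaceCentreConstruction.LocalEngine

namespace Iota3

open Summit.ResolutionOfSingularities.ResolutionOfSingularities.Theorems

/-- The exponent map of the transport: `x^{γ₀} y^{γ₁} z^{γ₂} ↦ T^{γ₀ + bγ₁ − bν} z^{γ₂} W^{γ₁}` (frame `(T, z, W)`). [OURS] -/
theorem transportExp_spec (b ν : ℕ) (γ : Fin 3 → ℕ) :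
    (![γ 0 + b * γ 1 - b * ν, γ 2, γ 1] : Fin 3 → ℕ) 0 = γ 0 + b * γ 1 - b * ν ∧
      (![γ 0 + b * γ 1 - b * ν, γ 2, γ 1] : Fin 3 → ℕ) 1 = γ 2 ∧ (![γ 0 + b * γ 1 - b * ν, γ 2, γ 1] : Fin 3 → ℕ) 2 = γ 1 := by
  simp

/-- No truncation on the face: `q·b ≤ r`, `0 < q` and `rν ≤ qγ₀ + rγ₁` give `bν ≤ γ₀ + bγ₁`. [folklore] -/
theorem le_of_face {q r b ν γ₀ γ₁ : ℕ} (hq : 0 < q) (hqb : q * b ≤ r) (hface : r * ν ≤ q * γ₀ + r * γ₁) : b * ν ≤ γ₀ + b * γ₁ := by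
  rcases le_or_gt ν γ₁ with h | h
  · nlinarith
  · obtain ⟨m, rfl⟩ : ∃ m, ν = γ₁ + m := ⟨ν - γ₁, by omega⟩
    have h1 : r * m ≤ q * γ₀ := by nlinarith
    have h2 : q * (b * m) ≤ q * γ₀ := le_trans (by nlinarith) h1
    have h3 : b * m ≤ γ₀ := Nat.le_of_mul_le_mul_left h2 hq
    nlinarith

/-- The transport map is injective on the face. [folklore] -/
theorem transportExp_injOn {q r b ν : ℕ} (hq : 0 < q) (hqb : q * b ≤ r) {Δ : Finset (Fin 3 → ℕ)}
    (hface : ∀ γ ∈ Δ, r * ν ≤ q * γ 0 + r * γ 1) :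
    Set.InjOn (fun γ : Fin 3 → ℕ => (![γ 0 + b * γ 1 - b * ν, γ 2, γ 1] : Fin 3 → ℕ)) Δ := by
  intro γ hγ γ' hγ' h
  have h0 : (![γ 0 + b * γ 1 - b * ν, γ 2, γ 1] : Fin 3 → ℕ) 0 = (![γ' 0 + b * γ' 1 - b * ν, γ' 2, γ' 1] : Fin 3 → ℕ) 0 :=
    congr_fun h 0
  have h1 : (![γ 0 + b * γ 1 - b * ν, γ 2, γ 1] : Fin 3 → ℕ) 1 = (![γ' 0 + b * γ' 1 - b * ν, γ' 2, γ' 1] : Fin 3 → ℕ) 1 :=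
    congr_fun h 1
  have h2 : (![γ 0 + b * γ 1 - b * ν, γ 2, γ 1] : Fin 3 → ℕ) 2 = (![γ' 0 + b * γ' 1 - b * ν, γ' 2, γ' 1] : Fin 3 → ℕ) 2 :=
    congr_fun h 2
  simp only [Matrix.cons_val_zero, Matrix.cons_val_one, Matrix.cons_val_two, Matrix.tail_cons, Matrix.head_cons] at h0 h1 h2
  have hb := le_of_face hq hqb (hface γ hγ)
  have hb' := le_of_face hq hqb (hface γ' hγ')
  rw [h2] at h0 hb
  funext i; fin_cases i
  · show γ 0 = γ' 0; omega
  · show γ 1 = γ' 1; exact h2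
  · show γ 2 = γ' 2; exact h1

set_option maxHeartbeats 400000 in
/-- **Transport of a face-supported unit expansion to the pinned successor** (carrier form: any filtration EQUAL to `𝒥((y,x);(b,1))`).
`S` regular local with `𝔪 = (y, x, z)` of embedding dimension `3`; `1 ≤ b`, `q·b ≤ r`, `0 < q`; `f ∈ 𝒥_{bν} ∖ 𝔪^{ν+1}`;
`f ≡ Σ_{γ ∈ Δ} a_γ x^{γ₀} y^{γ₁} z^{γ₂} (mod 𝔪^M)` with unit coefficients on the face `rν ≤ qγ₀ + rγ₁`.  At a prime `𝔫 ∋ W` of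
`B = S[t⁻¹, 𝒥ₙtⁿ]` over `𝔪_S`, off the vertex, with `y = (t⁻¹)^b W` and a saturated factorisation `f = (t⁻¹)^a g`:
`g/1 ≡ Σ_{α ∈ Δ'} a'_α T^{α₀} z^{α₁} W^{α₂} (mod 𝔪_{B_𝔫}^{M − bν})` in `B_𝔫` (regular local of dimension `3` with `(t⁻¹, z, W)/1 = 𝔪`), where
`Δ'` is the image of `Δ` under `γ ↦ (γ₀ + bγ₁ − bν, γ₂, γ₁)` and the coefficients are units. [OURS · L1 W4.3] [cite: Wlodarczyk2022, §2.3.9, §3.3] -/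
theorem transport_faceExpansion_aux {S : Type} [CommRing S] [IsRegularLocalRing S] {y x z : S} {b q r ν M : ℕ} {f : S}
    (hyxz : Ideal.span (Set.range ![y, x, z]) = maximalIdeal S) (hd : (maximalIdeal S).spanFinrank = 3) (hb : 1 ≤ b)
    (hq : 0 < q) (hqb : q * b ≤ r) (hfν1 : f ∉ maximalIdeal S ^ (ν + 1)) (hadm : f ∈ weightedMonomialIdeal ![y, x] ![b, 1] (b * ν))
    {Δ : Finset (Fin 3 → ℕ)} {aS : (Fin 3 → ℕ) → S} (hunitS : ∀ γ ∈ Δ, IsUnit (aS γ))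
    (hfaceS : ∀ γ ∈ Δ, r * ν ≤ q * γ 0 + r * γ 1) (hrS : f - ∑ γ ∈ Δ, aS γ * ∏ i, ![x, y, z] i ^ γ i ∈ maximalIdeal S ^ M)
    {I : ℕ → Ideal S} (hI : I = weightedMonomialIdeal ![y, x] ![b, 1]) :
    ∀ (𝔫 : Ideal (extReesAlgebra I)) [𝔫.IsPrime],
      (maximalIdeal S).map (algebraMap S (extReesAlgebra I)) ≤ 𝔫 → ¬ extReesAlgebra.vertexIdeal I ≤ 𝔫 →
      ∀ (a : ℕ) (g : extReesAlgebra I), algebraMap S (extReesAlgebra I) f = extReesAlgebra.tInv I ^ a * g →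
        ¬ extReesAlgebra.tInv I ∣ g →
        ∀ W : extReesAlgebra I, algebraMap S (extReesAlgebra I) y = extReesAlgebra.tInv I ^ b * W → W ∈ 𝔫 →
          IsRegularLocalRing (Localization.AtPrime 𝔫) → ringKrullDim (Localization.AtPrime 𝔫) = (3 : ℕ) →
          Ideal.span {algebraMap _ (Localization.AtPrime 𝔫) (extReesAlgebra.tInv I),
              algebraMap _ (Localization.AtPrime 𝔫) (algebraMap S (extReesAlgebra I) z),
              algebraMap _ (Localization.AtPrime 𝔫) W} = maximalIdeal (Localization.AtPrime 𝔫) →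
          ∃ a' : (Fin 3 → ℕ) → Localization.AtPrime 𝔫,
            (∀ α ∈ Δ.image (fun γ : Fin 3 → ℕ => (![γ 0 + b * γ 1 - b * ν, γ 2, γ 1] : Fin 3 → ℕ)), IsUnit (a' α)) ∧
            algebraMap (extReesAlgebra I) (Localization.AtPrime 𝔫) g -
                ∑ α ∈ Δ.image (fun γ : Fin 3 → ℕ => (![γ 0 + b * γ 1 - b * ν, γ 2, γ 1] : Fin 3 → ℕ)),
                  a' α * ∏ i, ![algebraMap _ (Localization.AtPrime 𝔫) (extReesAlgebra.tInv I),
                    algebraMap _ (Localization.AtPrime 𝔫) (algebraMap S (extReesAlgebra I) z),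
                    algebraMap _ (Localization.AtPrime 𝔫) W] i ^ α i ∈
              maximalIdeal (Localization.AtPrime 𝔫) ^ (M - b * ν) := by
  classical
  subst hI
  haveI := isDomain_of_isRegularLocalRing S
  intro 𝔫 _ hM𝔫 hV a g hfg hTg W hW hW𝔫 hR1 hR2 hR3
  haveI := hR1
  set T : extReesAlgebra (weightedMonomialIdeal ![y, x] ![b, 1]) := extReesAlgebra.tInv (weightedMonomialIdeal ![y, x] ![b, 1])
    with hTdef
  -- `a = bν`, `W = Y`, `x = T·X` with `X ∉ 𝔫`
  have ha : a = b * ν := LocalGameEFTCylinder.transform_eq_of_saturated hyxz hd Nat.one_pos hb hfν1 hadm hfg hTg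
  subst ha
  have hWY : W = LocalGameEFTPointMove.uT ![y, x] ![b, 1] 0 := LocalGameEFTCylinder.eq_uT_zero_of_algebraMap_y_eq hW
  set X : extReesAlgebra (weightedMonomialIdeal ![y, x] ![b, 1]) := LocalGameEFTPointMove.uT ![y, x] ![b, 1] 1 with hXdef
  have hx : algebraMap S (extReesAlgebra (weightedMonomialIdeal ![y, x] ![b, 1])) x = T * X := by
    have h := LocalGameEFTPointMove.algebraMap_u_eq ![y, x] ![b, 1] 1
    have e1 : (![y, x] : Fin 2 → S) 1 = x := by simp
    have e2 : (![b, 1] : Fin 2 → ℕ) 1 = 1 := by simp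
    rw [e1, e2, pow_one] at h
    exact h
  have hX𝔫 : X ∉ 𝔫 := by
    intro hX
    apply hV
    have hall : ∀ i : Fin 2, LocalGameEFTPointMove.uT ![y, x] ![b, 1] i ∈ 𝔫 :=
      Fin.forall_fin_two.mpr ⟨by rw [← hWY]; exact hW𝔫, hX⟩
    refine (LocalGameEFTPointMove.vertexIdeal_le_span_range_uT ![y, x] ![b, 1]).trans (Ideal.span_le.mpr ?_)
    rintro _ ⟨i, rfl⟩
    exact hall i
  -- in `L`
  set φ : extReesAlgebra (weightedMonomialIdeal ![y, x] ![b, 1]) →+* Localization.AtPrime 𝔫 :=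
    algebraMap (extReesAlgebra (weightedMonomialIdeal ![y, x] ![b, 1])) (Localization.AtPrime 𝔫) with hφ
  set T₁ : Localization.AtPrime 𝔫 := φ T with hT₁
  set X₁ : Localization.AtPrime 𝔫 := φ X with hX₁
  set W₁ : Localization.AtPrime 𝔫 := φ W with hW₁
  set z₁ : Localization.AtPrime 𝔫 := φ (algebraMap S (extReesAlgebra (weightedMonomialIdeal ![y, x] ![b, 1])) z) with hz₁
  have hX₁u : IsUnit X₁ := IsLocalization.map_units (Localization.AtPrime 𝔫) (⟨X, hX𝔫⟩ : 𝔫.primeCompl)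
  have hmapS : ∀ s ∈ maximalIdeal S, φ (algebraMap S (extReesAlgebra (weightedMonomialIdeal ![y, x] ![b, 1])) s) ∈ maximalIdeal (Localization.AtPrime 𝔫) := by
    intro s hs
    have h1 : algebraMap S (extReesAlgebra (weightedMonomialIdeal ![y, x] ![b, 1])) s ∈ 𝔫 := hM𝔫 (Ideal.mem_map_of_mem _ hs)
    have h2 : ¬ IsUnit (φ (algebraMap S (extReesAlgebra (weightedMonomialIdeal ![y, x] ![b, 1])) s)) := fun hu =>
      ((IsLocalization.AtPrime.isUnit_to_map_iff (Localization.AtPrime 𝔫) 𝔫 (algebraMap S (extReesAlgebra (weightedMonomialIdeal ![y, x] ![b, 1])) s)).mp hu) h1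
    exact (IsLocalRing.mem_maximalIdeal _).mpr h2
  have hmapS_pow : ∀ (s : S) (n : ℕ), s ∈ maximalIdeal S ^ n → φ (algebraMap S (extReesAlgebra (weightedMonomialIdeal ![y, x] ![b, 1])) s) ∈ maximalIdeal (Localization.AtPrime 𝔫) ^ n := by
    intro s n hs
    have h1 : (maximalIdeal S).map ((φ).comp (algebraMap S (extReesAlgebra (weightedMonomialIdeal ![y, x] ![b, 1])))) ≤ maximalIdeal (Localization.AtPrime 𝔫) := by
      rw [Ideal.map_le_iff_le_comap]
      intro t ht
      exact hmapS t ht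
    have h2 := Ideal.mem_map_of_mem ((φ).comp (algebraMap S (extReesAlgebra (weightedMonomialIdeal ![y, x] ![b, 1])))) hs
    rw [Ideal.map_pow] at h2
    exact Ideal.pow_right_mono h1 n h2
  -- the transported sum
  set φe : (Fin 3 → ℕ) → (Fin 3 → ℕ) := fun γ => ![γ 0 + b * γ 1 - b * ν, γ 2, γ 1] with hφe
  set ψ : (Fin 3 → ℕ) → (Fin 3 → ℕ) := fun α => ![α 0 + b * ν - b * α 2, α 2, α 1] with hψ
  have hψφ : ∀ γ ∈ Δ, ψ (φe γ) = γ := by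
    intro γ hγ
    have hle := le_of_face hq hqb (hfaceS γ hγ)
    funext i; fin_cases i
    · show (ψ (φe γ)) 0 = γ 0
      simp only [hψ, hφe, Matrix.cons_val_zero, Matrix.cons_val_two, Matrix.tail_cons, Matrix.head_cons]
      omega
    · show (ψ (φe γ)) 1 = γ 1
      simp [hψ, hφe]
    · show (ψ (φe γ)) 2 = γ 2
      simp [hψ, hφe]
  set a' : (Fin 3 → ℕ) → Localization.AtPrime 𝔫 := fun α => φ (algebraMap S (extReesAlgebra (weightedMonomialIdeal ![y, x] ![b, 1])) (aS (ψ α))) * X₁ ^ (ψ α 0) with ha'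
  refine ⟨a', ?_, ?_⟩
  · intro α hα
    obtain ⟨γ, hγ, rfl⟩ := Finset.mem_image.mp hα
    simp only [ha', hψφ γ hγ]
    exact (((hunitS γ hγ).map (algebraMap S (extReesAlgebra (weightedMonomialIdeal ![y, x] ![b, 1])))).map φ).mul (hX₁u.pow _)
  · -- the identity `T₁^{bν} · (g/1 − Σ') = image of the remainder`
    have hinj := transportExp_injOn (b := b) (ν := ν) hq hqb hfaceS
    rw [Finset.sum_image hinj]
    have hmon : ∀ γ ∈ Δ, a' (φe γ) * ∏ i, ![T₁, z₁, W₁] i ^ (φe γ) i =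
        φ (algebraMap S (extReesAlgebra (weightedMonomialIdeal ![y, x] ![b, 1])) (aS γ)) * X₁ ^ γ 0 * (T₁ ^ (γ 0 + b * γ 1 - b * ν) * z₁ ^ γ 2 * W₁ ^ γ 1) := by
      intro γ hγ
      have e1 : a' (φe γ) = φ (algebraMap S (extReesAlgebra (weightedMonomialIdeal ![y, x] ![b, 1])) (aS γ)) * X₁ ^ γ 0 := by
        simp only [ha', hψφ γ hγ]
      rw [e1]
      simp only [hφe, Fin.prod_univ_three, Matrix.cons_val_zero, Matrix.cons_val_one, Matrix.cons_val_two,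
        Matrix.tail_cons, Matrix.head_cons]
    rw [Finset.sum_congr rfl hmon]
    have hterm : ∀ γ ∈ Δ, φ (algebraMap S (extReesAlgebra (weightedMonomialIdeal ![y, x] ![b, 1])) (aS γ * ∏ i, ![x, y, z] i ^ γ i)) =
        T₁ ^ (b * ν) * (φ (algebraMap S (extReesAlgebra (weightedMonomialIdeal ![y, x] ![b, 1])) (aS γ)) * X₁ ^ γ 0 * (T₁ ^ (γ 0 + b * γ 1 - b * ν) * z₁ ^ γ 2 * W₁ ^ γ 1)) := by
      intro γ hγ
      have hle := le_of_face hq hqb (hfaceS γ hγ)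
      simp only [Fin.prod_univ_three, Matrix.cons_val_zero, Matrix.cons_val_one, Matrix.cons_val_two, Matrix.tail_cons,
        Matrix.head_cons, map_mul, map_pow, hx, hW]
      have hpow : (φ T) ^ γ 0 * (φ T) ^ (b * γ 1) = (φ T) ^ (b * ν) * (φ T) ^ (γ 0 + b * γ 1 - b * ν) := by
        rw [← pow_add, ← pow_add]; congr 1; omega
      rw [hT₁, hX₁, hW₁, hz₁]
      calc φ (algebraMap S (extReesAlgebra (weightedMonomialIdeal ![y, x] ![b, 1])) (aS γ)) * ((φ T * φ X) ^ γ 0 * (φ T ^ b * φ W) ^ γ 1 * φ (algebraMap S (extReesAlgebra (weightedMonomialIdeal ![y, x] ![b, 1])) z) ^ γ 2)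
          = φ (algebraMap S (extReesAlgebra (weightedMonomialIdeal ![y, x] ![b, 1])) (aS γ)) * φ X ^ γ 0 * φ W ^ γ 1 * φ (algebraMap S (extReesAlgebra (weightedMonomialIdeal ![y, x] ![b, 1])) z) ^ γ 2 * (φ T ^ γ 0 * φ T ^ (b * γ 1)) := by
            rw [mul_pow, mul_pow, ← pow_mul]; ring
        _ = _ := by rw [hpow]; ring
    have hsum : φ (algebraMap S (extReesAlgebra (weightedMonomialIdeal ![y, x] ![b, 1])) (∑ γ ∈ Δ, aS γ * ∏ i, ![x, y, z] i ^ γ i)) =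
        T₁ ^ (b * ν) * ∑ γ ∈ Δ, φ (algebraMap S (extReesAlgebra (weightedMonomialIdeal ![y, x] ![b, 1])) (aS γ)) * X₁ ^ γ 0 * (T₁ ^ (γ 0 + b * γ 1 - b * ν) * z₁ ^ γ 2 * W₁ ^ γ 1) := by
      rw [map_sum, map_sum, Finset.mul_sum]
      exact Finset.sum_congr rfl hterm
    have ef : φ (algebraMap S (extReesAlgebra (weightedMonomialIdeal ![y, x] ![b, 1])) f) = T₁ ^ (b * ν) * φ g := by
      rw [hfg, map_mul, map_pow]
    have hrem := hmapS_pow _ M hrS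
    rw [map_sub, map_sub, hsum, ef] at hrem
    replace hrem : T₁ ^ (b * ν) * (φ g - ∑ γ ∈ Δ, φ (algebraMap S (extReesAlgebra (weightedMonomialIdeal ![y, x] ![b, 1])) (aS γ)) *
        X₁ ^ γ 0 * (T₁ ^ (γ 0 + b * γ 1 - b * ν) * z₁ ^ γ 2 * W₁ ^ γ 1)) ∈ maximalIdeal (Localization.AtPrime 𝔫) ^ M := by
      convert hrem using 1; ring
    -- cancel `T₁^{bν}` against the `𝔪`-adic order
    have hu' : Ideal.span (Set.range ![T₁, z₁, W₁]) = maximalIdeal (Localization.AtPrime 𝔫) := by rw [range_three]; exact hR3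
    have h := LocalGameEFTNewton.mem_pow_of_parameter_pow_mul_mem_pow ![T₁, z₁, W₁] hu' hR2 0 (b * ν) hrem
    simpa only [Matrix.cons_val_zero] using h

/-- **Transport of a face-supported unit expansion to the pinned successor, for every presentation `(u, w)` of `𝒥((y,x);(b,1))`.**
(See `transport_faceExpansion_aux`.) [OURS · L1 W4.3] [cite: Wlodarczyk2022, §2.3.9, §3.3] -/
theorem transport_faceExpansion {S : Type} [CommRing S] [IsRegularLocalRing S] {y x z : S} {b q r ν M : ℕ} {f : S}
    (hyxz : Ideal.span (Set.range ![y, x, z]) = maximalIdeal S) (hd : (maximalIdeal S).spanFinrank = 3) (hb : 1 ≤ b)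
    (hq : 0 < q) (hqb : q * b ≤ r) (hfν1 : f ∉ maximalIdeal S ^ (ν + 1)) (hadm : f ∈ weightedMonomialIdeal ![y, x] ![b, 1] (b * ν))
    {Δ : Finset (Fin 3 → ℕ)} {aS : (Fin 3 → ℕ) → S} (hunitS : ∀ γ ∈ Δ, IsUnit (aS γ))
    (hfaceS : ∀ γ ∈ Δ, r * ν ≤ q * γ 0 + r * γ 1) (hrS : f - ∑ γ ∈ Δ, aS γ * ∏ i, ![x, y, z] i ^ γ i ∈ maximalIdeal S ^ M)
    {n : ℕ} (u : Fin n → S) (w : Fin n → ℕ) (hpres : ∀ m : ℕ, weightedMonomialIdeal u w m = weightedMonomialIdeal ![y, x] ![b, 1] m)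
    (𝔫 : Ideal (cobordantAlgebra' u w)) [𝔫.IsPrime]
    (hM𝔫 : (maximalIdeal S).map (algebraMap S (cobordantAlgebra' u w)) ≤ 𝔫)
    (hV : ¬ extReesAlgebra.vertexIdeal (weightedMonomialIdeal u w) ≤ 𝔫)
    {a : ℕ} {g : cobordantAlgebra' u w} (hfg : algebraMap S (cobordantAlgebra' u w) f = cobordantT' u w ^ a * g)
    (hTg : ¬ cobordantT' u w ∣ g) (W : cobordantAlgebra' u w) (hW : algebraMap S (cobordantAlgebra' u w) y = cobordantT' u w ^ b * W)
    (hW𝔫 : W ∈ 𝔫) (hR1 : IsRegularLocalRing (Localization.AtPrime 𝔫)) (hR2 : ringKrullDim (Localization.AtPrime 𝔫) = (3 : ℕ))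
    (hR3 : Ideal.span {algebraMap _ (Localization.AtPrime 𝔫) (cobordantT' u w),
      algebraMap _ (Localization.AtPrime 𝔫) (algebraMap S (cobordantAlgebra' u w) z),
      algebraMap _ (Localization.AtPrime 𝔫) W} = maximalIdeal (Localization.AtPrime 𝔫)) :
    ∃ a' : (Fin 3 → ℕ) → Localization.AtPrime 𝔫,
      (∀ α ∈ Δ.image (fun γ : Fin 3 → ℕ => (![γ 0 + b * γ 1 - b * ν, γ 2, γ 1] : Fin 3 → ℕ)), IsUnit (a' α)) ∧
      algebraMap (cobordantAlgebra' u w) (Localization.AtPrime 𝔫) g -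
          ∑ α ∈ Δ.image (fun γ : Fin 3 → ℕ => (![γ 0 + b * γ 1 - b * ν, γ 2, γ 1] : Fin 3 → ℕ)),
            a' α * ∏ i, ![algebraMap _ (Localization.AtPrime 𝔫) (cobordantT' u w),
              algebraMap _ (Localization.AtPrime 𝔫) (algebraMap S (cobordantAlgebra' u w) z),
              algebraMap _ (Localization.AtPrime 𝔫) W] i ^ α i ∈
        maximalIdeal (Localization.AtPrime 𝔫) ^ (M - b * ν) :=
  transport_faceExpansion_aux hyxz hd hb hq hqb hfν1 hadm hunitS hfaceS hrS (funext hpres) 𝔫 hM𝔫 hV a g hfg hTg W hW hW𝔫 hR1 hR2 hR3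

end Iota3

end Summit.ResolutionOfSingularities.ResolutionOfSingularities.Cruxes.HypersurfaceCentreConstruction.LocalEngine

end
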